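import Literature.AlgebraicGeometry.FormalGeometry.WittGEFrames
import HarnessLib

/-!
# Frames of `𝒪_X`-modules: open subschemes, gluing, local isomorphisms, finite local freeness

Helper file for stub `stub_pushforwardTransport` (line `chow-zariski-pushforward` of the crux
`PadicSemiregularLift.FormalVectorBundlesAlgebraize`, stmt-HodgeConjecture-14106), continuing
`PadicSemiregularLiftFormalVectorBundlesAlgebraizeFrames`:

* frames of `E` over `U` versus frames of the restriction `E|_U` over the open subscheme `U`
  (Mathlib `Scheme.Modules.restrictFunctor`, `restrictAppIso`), whence the bridge with the
  tree's restrict-form trivialisations `free ι ≅ (restrictFunctor U.ι).obj E` in both directions;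
* frames glue along open covers; a morphism bijective on the sections over a neighbourhood basis
  is an isomorphism;
* finite locally free modules (`IsFiniteLocallyFree`) have frames near every point, and
  conversely.

Everything is proved; no definitions.

Provenance: Literature home (family `hodge`, layer `Literature/AlgebraicGeometry/FormalGeometry`, namespace
`Literature.AlgebraicGeometry.FormalGeometry.WittGrothendieckExistence…`) of the Summits-side
`Theorems/PadicSemiregularLiftFormalVectorBundlesAlgebraizeFramesLocal` (route `PadicSemiregularLift` / `AnchorTransport`,
Grothendieck existence for vector bundles over `W(k)`), which `Literature/` may not import; theorems only, no
named fact, no definition. Lane `lit-hodgefound`, seat p20.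
-/

noncomputable section

open CategoryTheory CategoryTheory.Limits _root_.AlgebraicGeometry TopologicalSpace Opposite
open Literature.AlgebraicGeometry.Modules Literature.AlgebraicGeometry.Motives

universe u

namespace Literature.AlgebraicGeometry.FormalGeometry.WittGrothendieckExistence.FormalVectorBundlesAlgebraize

namespace PushforwardTransport

variable {X : Scheme.{u}}

/-! ### Restriction to an open subscheme -/

section Restrict

variable {ι : Type*} [Fintype ι]

/-- For `V ≤ U`, the open `V` is the image of its preimage in the open subscheme `U`. [cite: GortzWedhorn2023, proof of Thm. 24.94 and Prop. 24.95 (pp. 566–567), auxiliary step] -/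
theorem image_preimage_of_le {U V : X.Opens} (hV : V ≤ U) : U.ι ''ᵁ (U.ι ⁻¹ᵁ V) = V := by
  rw [Scheme.Hom.image_preimage_eq_opensRange_inf, Scheme.Opens.opensRange_ι]
  exact inf_eq_right.mpr hV

/-- Linear combinations of sections of `E|_U` over an open `O` of the open subscheme `U` are the
linear combinations of the same sections of `E` over `U.ι '' O` (Mathlib `restrictAppIso`,
`Opens.ι_appIso`). [cite: GortzWedhorn2023, proof of Thm. 24.94 and Prop. 24.95 (pp. 566–567), auxiliary step] -/
theorem restrictAppIso_hom_sum_smul (E : X.Modules) (U : X.Opens) (O : (U : Scheme.{u}).Opens)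
    (x : ι → Γ((Scheme.Modules.restrictFunctor U.ι).obj E, O))
    (a : ι → Γ((U : Scheme.{u}), O)) :
    (E.restrictAppIso U.ι O).hom (∑ i, a i • x i) =
      ∑ i, (show Γ(X, U.ι ''ᵁ O) from a i) • (E.restrictAppIso U.ι O).hom (x i) := by
  rw [map_sum]
  refine Finset.sum_congr rfl fun i _ => ?_
  change ((U.ι.appIso O).inv (a i)) • (E.restrictAppIso U.ι O).hom (x i) = _
  rw [Scheme.Opens.ι_appIso]
  rfl

/-- Frame bijectivity for `E|_U` over `O` is frame bijectivity for `E` over `U.ι '' O`. [cite: GortzWedhorn2023, proof of Thm. 24.94 and Prop. 24.95 (pp. 566–567), auxiliary step] -/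
theorem sum_smul_bijective_image_iff (E : X.Modules) (U : X.Opens) (O : (U : Scheme.{u}).Opens)
    (x : ι → Γ((Scheme.Modules.restrictFunctor U.ι).obj E, O)) :
    (Function.Bijective fun a : ι → Γ((U : Scheme.{u}), O) => ∑ i, a i • x i) ↔
      Function.Bijective fun a : ι → Γ(X, U.ι ''ᵁ O) =>
        ∑ i, a i • (E.restrictAppIso U.ι O).hom (x i) := by
  have heq : (fun a : ι → Γ(X, U.ι ''ᵁ O) => ∑ i, a i • (E.restrictAppIso U.ι O).hom (x i)) =
      (E.restrictAppIso U.ι O).hom ∘ fun a : ι → Γ((U : Scheme.{u}), O) => ∑ i, a i • x i := by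
    funext a
    exact (restrictAppIso_hom_sum_smul E U O x a).symm
  rw [heq]
  have hbij : Function.Bijective (E.restrictAppIso U.ι O).hom := ⟨fun _ _ h => h, fun y => ⟨y, rfl⟩⟩
  exact (Function.Bijective.of_comp_iff' hbij _).symm

/-- **Frames over `U` from frames of the restriction over `⊤`**: a frame of `E|_U` over the whole
open subscheme `U` is a frame of `E` over `U` (sections transported along `U.ι ''ᵁ ⊤ = U`,
Mathlib `Scheme.Modules.restrictAppIso`). [cite: GortzWedhorn2023, proof of Thm. 24.94 and Prop. 24.95 (pp. 566–567), auxiliary step] -/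
theorem frame_of_frame_restrict_top (E : X.Modules) (U : X.Opens)
    (c : ι → Γ((Scheme.Modules.restrictFunctor U.ι).obj E, ⊤))
    (hc : ∀ (O : (U : Scheme.{u}).Opens) (hO : O ≤ ⊤), Function.Bijective
      fun a : ι → Γ((U : Scheme.{u}), O) => ∑ i, a i •
        ((Scheme.Modules.restrictFunctor U.ι).obj E).presheaf.map (homOfLE hO).op (c i)) :
    ∀ (V : X.Opens) (hV : V ≤ U), Function.Bijective fun a : ι → Γ(X, V) =>
      ∑ i, a i • E.presheaf.map (homOfLE hV).op
        (E.presheaf.map (homOfLE (U.ι_image_top).ge).op ((E.restrictAppIso U.ι ⊤).hom (c i))) := by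
  intro V hV
  -- the frame of `E|_U` at the preimage `O` of `V`, an open of `X` equal to `V`
  have h := (sum_smul_bijective_image_iff E U (U.ι ⁻¹ᵁ V) _).mp (hc (U.ι ⁻¹ᵁ V) le_top)
  have h₁ : V ≤ U.ι ''ᵁ (U.ι ⁻¹ᵁ V) := (image_preimage_of_le hV).ge
  have h₂ : U.ι ''ᵁ (U.ι ⁻¹ᵁ V) ≤ V := (image_preimage_of_le hV).le
  have h' := sum_smul_bijective_of_le_of_le (M := E) h₁ h₂ _ h
  have heq : ∀ i, E.presheaf.map (homOfLE h₁).op ((E.restrictAppIso U.ι (U.ι ⁻¹ᵁ V)).hom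
      (((Scheme.Modules.restrictFunctor U.ι).obj E).presheaf.map
        (homOfLE (le_top (a := U.ι ⁻¹ᵁ V))).op (c i))) =
      E.presheaf.map (homOfLE hV).op
        (E.presheaf.map (homOfLE (U.ι_image_top).ge).op ((E.restrictAppIso U.ι ⊤).hom (c i))) := by
    intro i
    change E.presheaf.map _ (E.presheaf.map _ (c i)) = E.presheaf.map _ (E.presheaf.map _ (c i))
    rw [← CategoryTheory.comp_apply, ← Functor.map_comp, ← CategoryTheory.comp_apply,
      ← Functor.map_comp]
    exact presheaf_map_congr E _ _ (c i)
  simp_rw [heq] at h'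
  exact h'

/-- **Frames of the restriction over `⊤` from frames over `U`.** [cite: GortzWedhorn2023, proof of Thm. 24.94 and Prop. 24.95 (pp. 566–567), auxiliary step] -/
theorem frame_restrict_top_of_frame (E : X.Modules) (U : X.Opens) (b : ι → Γ(E, U))
    (hb : ∀ (V : X.Opens) (hV : V ≤ U), Function.Bijective fun a : ι → Γ(X, V) =>
      ∑ i, a i • E.presheaf.map (homOfLE hV).op (b i)) :
    ∀ (O : (U : Scheme.{u}).Opens) (hO : O ≤ ⊤), Function.Bijective
      fun a : ι → Γ((U : Scheme.{u}), O) => ∑ i, a i •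
        ((Scheme.Modules.restrictFunctor U.ι).obj E).presheaf.map (homOfLE hO).op
          ((E.restrictAppIso U.ι ⊤).inv (E.presheaf.map (homOfLE (U.ι_image_top).le).op (b i))) := by
  intro O hO
  have hOU : U.ι ''ᵁ O ≤ U := (U.ι.image_le_opensRange O).trans (Scheme.Opens.opensRange_ι U).le
  have h := hb (U.ι ''ᵁ O) hOU
  rw [sum_smul_bijective_image_iff]
  have heq : ∀ i, (E.restrictAppIso U.ι O).hom
      (((Scheme.Modules.restrictFunctor U.ι).obj E).presheaf.map (homOfLE hO).op
        ((E.restrictAppIso U.ι ⊤).inv (E.presheaf.map (homOfLE (U.ι_image_top).le).op (b i)))) =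
      E.presheaf.map (homOfLE hOU).op (b i) := by
    intro i
    change E.presheaf.map _ (E.presheaf.map _ (b i)) = _
    rw [← CategoryTheory.comp_apply, ← Functor.map_comp]
    exact presheaf_map_congr E _ _ (b i)
  simp_rw [heq]
  exact h

/-- **From a trivialisation of the restriction to a frame**: a trivialisation
`𝒪^ι ≅ E|_U` (Mathlib `SheafOfModules.free`, the tree's restrict-form of local freeness) yields a
frame of `E` over `U`. [cite: GortzWedhorn2023, proof of Thm. 24.94 and Prop. 24.95 (pp. 566–567), auxiliary step] -/
theorem exists_frame_of_freeIso_restrict {ι : Type u} [Fintype ι] (E : X.Modules) (U : X.Opens)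
    (e : SheafOfModules.free (R := (U : Scheme.{u}).ringCatSheaf) ι ≅
      (Scheme.Modules.restrictFunctor U.ι).obj E) :
    ∃ b : ι → Γ(E, U), ∀ (V : X.Opens) (hV : V ≤ U), Function.Bijective
      fun a : ι → Γ(X, V) => ∑ i, a i • E.presheaf.map (homOfLE hV).op (b i) := by
  let e' : (∐ fun _ : ι => unitModule (U : Scheme.{u})) ≅
      (Scheme.Modules.restrictFunctor U.ι).obj E := ⟨e.hom, e.inv, e.hom_inv_id, e.inv_hom_id⟩
  have h0 := frame_sigmaι (X := (U : Scheme.{u})) (ι := ι) ⊤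
  have h := frame_map_iso e' _ h0
  exact ⟨_, frame_of_frame_restrict_top E U _ h⟩

/-- **From a frame to a trivialisation of the restriction** `𝒪^ι ≅ E|_U`. [cite: GortzWedhorn2023, proof of Thm. 24.94 and Prop. 24.95 (pp. 566–567), auxiliary step] -/
theorem nonempty_freeIso_restrict_of_frame {ι : Type u} [Fintype ι] (E : X.Modules) (U : X.Opens)
    (b : ι → Γ(E, U))
    (hb : ∀ (V : X.Opens) (hV : V ≤ U), Function.Bijective fun a : ι → Γ(X, V) =>
      ∑ i, a i • E.presheaf.map (homOfLE hV).op (b i)) :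
    Nonempty (SheafOfModules.free (R := (U : Scheme.{u}).ringCatSheaf) ι ≅
      (Scheme.Modules.restrictFunctor U.ι).obj E) := by
  have h := frame_restrict_top_of_frame E U b hb
  obtain ⟨φ, -⟩ := exists_sigmaIso_of_frame_top _ h
  exact ⟨⟨φ.hom, φ.inv, φ.hom_inv_id, φ.inv_hom_id⟩⟩

end Restrict

/-! ### Frames glue; isomorphisms are local -/

section Local

variable {ι : Type*} [Fintype ι]

/-- Naturality of the frame map: restricting `∑ aᵢ • bᵢ|_V` to `V' ≤ V` gives `∑ aᵢ|_{V'} • bᵢ|_{V'}`. [cite: GortzWedhorn2023, proof of Thm. 24.94 and Prop. 24.95 (pp. 566–567), auxiliary step] -/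
theorem map_sum_smul_map {M : X.Modules} {U V V' : X.Opens} (hV : V ≤ U) (hV' : V' ≤ V)
    (b : ι → Γ(M, U)) (a : ι → Γ(X, V)) :
    M.presheaf.map (homOfLE hV').op (∑ i, a i • M.presheaf.map (homOfLE hV).op (b i)) =
      ∑ i, X.presheaf.map (homOfLE hV').op (a i) • M.presheaf.map (homOfLE (hV'.trans hV)).op (b i) := by
  rw [map_sum]
  refine Finset.sum_congr rfl fun i _ => ?_
  rw [Scheme.Modules.map_smul, ← CategoryTheory.comp_apply, ← Functor.map_comp]
  rfl

/-- **Frames glue**: a family of sections over `U` which is a frame over each member of an open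
cover of `U` is a frame over `U` (sheaf axiom for `𝒪_X` and for `M`). [cite: GortzWedhorn2023, proof of Thm. 24.94 and Prop. 24.95 (pp. 566–567), auxiliary step] -/
theorem frame_of_frame_cover {M : X.Modules} {U : X.Opens} {κ : Type*} (W : κ → X.Opens)
    (hW : ∀ k, W k ≤ U) (hcov : U ≤ ⨆ k, W k) (b : ι → Γ(M, U))
    (h : ∀ (k : κ) (V : X.Opens) (hV : V ≤ W k), Function.Bijective fun a : ι → Γ(X, V) =>
      ∑ i, a i • M.presheaf.map (homOfLE (hV.trans (hW k))).op (b i)) :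
    ∀ (V : X.Opens) (hV : V ≤ U), Function.Bijective fun a : ι → Γ(X, V) =>
      ∑ i, a i • M.presheaf.map (homOfLE hV).op (b i) := by
  intro V hV
  -- the cover `V ∩ W k` of `V`
  let O : κ → X.Opens := fun k => V ⊓ W k
  have hO : ∀ k, O k ≤ V := fun k => inf_le_left
  have hOcov : V ≤ ⨆ k, O k := by
    intro x hx
    obtain ⟨k, hk⟩ := Opens.mem_iSup.mp (hcov (hV hx))
    exact Opens.mem_iSup.mpr ⟨k, hx, hk⟩
  -- the frame map is bijective over every open below some `W k`, e.g. below some `O k`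
  have hbij : ∀ (k : κ) (Y : X.Opens) (hY : Y ≤ O k), Function.Bijective fun a : ι → Γ(X, Y) =>
      ∑ i, a i • M.presheaf.map (homOfLE (hY.trans ((hO k).trans hV))).op (b i) := by
    intro k Y hY
    have h' := h k Y (hY.trans inf_le_right)
    have heq : ∀ i, M.presheaf.map (homOfLE ((hY.trans inf_le_right).trans (hW k))).op (b i) =
        M.presheaf.map (homOfLE (hY.trans ((hO k).trans hV))).op (b i) :=
      fun i => presheaf_map_congr M _ _ (b i)
    simp_rw [heq] at h'
    exact h'
  let Msh : TopCat.Sheaf Ab X.carrier := ⟨M.presheaf, M.isSheaf⟩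
  constructor
  · intro a a' haa'
    funext i
    refine TopCat.Sheaf.eq_of_locally_eq' X.sheaf O V (fun k => homOfLE (hO k)) hOcov (a i) (a' i)
      fun k => ?_
    have hk := congrArg (M.presheaf.map (homOfLE (hO k)).op) haa'
    simp only [map_sum_smul_map] at hk
    exact congrFun ((hbij k (O k) le_rfl).1 hk) i
  · intro m
    -- local coordinates of `m`
    have hloc := fun k => (hbij k (O k) le_rfl).2 (M.presheaf.map (homOfLE (hO k)).op m)
    choose c hc using hloc
    -- they are compatible on overlaps
    have hcompat : ∀ i, TopCat.Presheaf.IsCompatible X.sheaf.1 O (fun k => c k i) := by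
      intro i k l
      have hkl : O k ⊓ O l ≤ O k := inf_le_left
      have hkl' : O k ⊓ O l ≤ O l := inf_le_right
      have e₁ := congrArg (M.presheaf.map (homOfLE hkl).op) (hc k)
      have e₂ := congrArg (M.presheaf.map (homOfLE hkl').op) (hc l)
      simp only [map_sum_smul_map] at e₁ e₂
      rw [← CategoryTheory.comp_apply, ← Functor.map_comp] at e₁ e₂
      have e : (fun a : ι → Γ(X, O k ⊓ O l) =>
          ∑ i, a i • M.presheaf.map (homOfLE (hkl.trans ((hO k).trans hV))).op (b i))
            (fun i => X.presheaf.map (homOfLE hkl).op (c k i)) =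
          (fun a : ι → Γ(X, O k ⊓ O l) =>
          ∑ i, a i • M.presheaf.map (homOfLE (hkl.trans ((hO k).trans hV))).op (b i))
            (fun i => X.presheaf.map (homOfLE hkl').op (c l i)) := by
        change (∑ i, _ • _) = ∑ i, _ • _
        rw [e₁]
        have heq : ∀ i, M.presheaf.map (homOfLE (hkl'.trans ((hO l).trans hV))).op (b i) =
            M.presheaf.map (homOfLE (hkl.trans ((hO k).trans hV))).op (b i) :=
          fun i => presheaf_map_congr M _ _ (b i)
        simp_rw [heq] at e₂
        rw [e₂]
        exact presheaf_map_congr M _ _ m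
      exact congrFun ((hbij k (O k ⊓ O l) hkl).1 e) i
    -- glue each coordinate
    have hglue := fun i => TopCat.Sheaf.existsUnique_gluing' X.sheaf O V (fun k => homOfLE (hO k))
      hOcov (fun k => c k i) (hcompat i)
    choose a ha _ using hglue
    refine ⟨fun i => show Γ(X, V) from a i, ?_⟩
    refine TopCat.Sheaf.eq_of_locally_eq' Msh O V (fun k => homOfLE (hO k)) hOcov _ m fun k => ?_
    change M.presheaf.map (homOfLE (hO k)).op (∑ i, (show Γ(X, V) from a i) • _) =
      M.presheaf.map (homOfLE (hO k)).op m
    rw [map_sum_smul_map, ← hc k]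
    refine Finset.sum_congr rfl fun i _ => ?_
    have hik : X.presheaf.map (homOfLE (hO k)).op (show Γ(X, V) from a i) = c k i := ha i k
    rw [hik]

/-- **Isomorphisms of `𝒪_X`-modules are local**: a morphism bijective on the sections over all
opens below the members of a neighbourhood cover is an isomorphism (Mathlib
`TopCat.Sheaf.isIso_iff_isIso_basis` for the basis of such opens). [cite: GortzWedhorn2023, proof of Thm. 24.94 and Prop. 24.95 (pp. 566–567), auxiliary step] -/
theorem isIso_of_nhds_bijective {M N : X.Modules} (φ : M ⟶ N)
    (h : ∀ x : X, ∃ O : X.Opens, x ∈ O ∧ ∀ V : X.Opens, V ≤ O → Function.Bijective (φ.app V)) :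
    IsIso φ := by
  let B : Type u := {V : X.Opens // ∀ V' : X.Opens, V' ≤ V → Function.Bijective (φ.app V')}
  have hB : Opens.IsBasis (Set.range (Subtype.val : B → X.Opens)) := by
    refine Opens.isBasis_iff_nbhd.mpr fun {O' x} hx => ?_
    obtain ⟨O, hxO, hO⟩ := h x
    exact ⟨O ⊓ O', ⟨⟨O ⊓ O', fun V' hV' => hO V' (hV'.trans inf_le_left)⟩, rfl⟩, ⟨hxO, hx⟩,
      inf_le_right⟩
  let φ' : (⟨M.presheaf, M.isSheaf⟩ : TopCat.Sheaf Ab X.carrier) ⟶ ⟨N.presheaf, N.isSheaf⟩ :=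
    ⟨φ.mapPresheaf⟩
  have h' : IsIso φ' := TopCat.Sheaf.isIso_iff_isIso_basis hB fun V =>
    (ConcreteCategory.isIso_iff_bijective _).mpr (V.2 V.1 le_rfl)
  have h'' : IsIso ((Scheme.Modules.toPresheaf X).map φ) :=
    (inferInstance : IsIso ((sheafToPresheaf _ _).map φ'))
  exact isIso_of_reflects_iso φ (Scheme.Modules.toPresheaf X)

end Local

/-! ### Finite locally free modules have frames near every point, and conversely -/

/-- **Finite locally free modules have frames near every point.** [cite: GortzWedhorn2023, proof of Thm. 24.94 and Prop. 24.95 (pp. 566–567), auxiliary step] -/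
theorem exists_frame_nhds_of_isFiniteLocallyFree {E : X.Modules} (hE : IsFiniteLocallyFree E)
    (x : X) :
    ∃ U : X.Opens, x ∈ U ∧ ∃ (ι : Type u) (_ : Fintype ι) (b : ι → Γ(E, U)),
      ∀ (V : X.Opens) (hV : V ≤ U), Function.Bijective fun a : ι → Γ(X, V) =>
        ∑ i, a i • E.presheaf.map (homOfLE hV).op (b i) := by
  obtain ⟨U, hxU, ι, hι, ⟨e⟩⟩ := hE.exists_free_iso_restrict x
  haveI := Fintype.ofFinite ι
  obtain ⟨b, hb⟩ := exists_frame_of_freeIso_restrict E U e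
  exact ⟨U, hxU, ι, inferInstance, b, hb⟩

/-- **A module with frames near every point is finite locally free.** [cite: GortzWedhorn2023, proof of Thm. 24.94 and Prop. 24.95 (pp. 566–567), auxiliary step] -/
theorem isFiniteLocallyFree_of_frame_nhds {E : X.Modules}
    (h : ∀ x : X, ∃ U : X.Opens, x ∈ U ∧ ∃ (ι : Type u) (_ : Fintype ι) (b : ι → Γ(E, U)),
      ∀ (V : X.Opens) (hV : V ≤ U), Function.Bijective fun a : ι → Γ(X, V) =>
        ∑ i, a i • E.presheaf.map (homOfLE hV).op (b i)) :
    IsFiniteLocallyFree E := by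
  refine Literature.AlgebraicGeometry.KTheory.isFiniteLocallyFree_of_restrict fun x => ?_
  obtain ⟨U, hxU, ι, _, b, hb⟩ := h x
  exact ⟨U, hxU, ι, Finite.of_fintype ι, nonempty_freeIso_restrict_of_frame E U b hb⟩

end PushforwardTransport

/-! ### Registered sub-goal -/

/-- **Registered sub-goal** (helper stub of `stub_pushforwardTransport`, universe `0`): a morphism
of `𝒪_X`-modules bijective on the sections over a neighbourhood basis is an isomorphism
(`isIso_of_nhds_bijective`). [cite: GortzWedhorn2023, proof of Thm. 24.94 and Prop. 24.95 (pp. 566–567), auxiliary step] -/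
theorem stub_isIsoOfLocallyBijective :
    ∀ (X : AlgebraicGeometry.Scheme.{0}) (M N : X.Modules) (φ : M ⟶ N),
      (∀ x : X, ∃ O : X.Opens, x ∈ O ∧ ∀ V : X.Opens, V ≤ O → Function.Bijective (φ.app V)) →
      CategoryTheory.IsIso φ :=
  fun _ _ _ φ h => PushforwardTransport.isIso_of_nhds_bijective φ h

end Literature.AlgebraicGeometry.FormalGeometry.WittGrothendieckExistence.FormalVectorBundlesAlgebraize

end
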